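import Literature.GroupTheory.ArithmeticGroups.SL2TwoPowCentralExtension
import HarnessLib

/-!
# The `2`-part of the Schur multiplier of `SL₂(ℤ/2^e)`: the generic descent (`e ≥ 5`)

For a central extension `π : E ↠ SL₂(ℤ/2^e)` whose kernel has exponent `2` and a lift `t` of `T̄ = (1 1; 0 1)`
put `τ := t^{2^e} ∈ ker π`.  The Schur multiplier of `SL₂(ℤ/2^e)` is `ℤ/2` for `e ≥ 2` ([Beyl1986]), so
`ker π ∩ [E, E]` need not vanish; the correct statement is `ker π ∩ [E, E] ⊆ ⟨τ⟩`.  Let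
`P(e) :⟺` for every such extension, `τ = 1 ⟹ ker π ∩ [E, E] = 1`.

* `step` (**generic descent**, `e ≥ 5`): `P(e-1) ⟹ ker π ∩ [E, E] ⊆ ⟨τ⟩` for every central extension of
  `SL₂(ℤ/2^e)` with kernel of exponent `2`.  The complement is CANONICAL: `W` = the squares of the preimage of the
  double layer (`SL2TwoPowCentralExtension`); it is normal, maps onto the top layer, meets `ker π` inside `⟨τ⟩`
  (`sq_mem_zpowers`), and `E/W` is a central extension of `SL₂(ℤ/2^{e-1})` with kernel of exponent `2` in which
  `t^{2^{e-1}} ≡ e_h² ∈ W` is trivial.  No cocycle constant is computed.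
* `P_of_P_pred` : `P(e-1) ⟹ P(e)` (`e ≥ 5`), and `forall_P_of_base` : `P(4) ⟹ P(e)` for all `e ≥ 4`;
  `mem_zpowers_of_base` : `P(4) ⟹ ker π ∩ [E, E] ⊆ ⟨τ⟩` for all `e ≥ 5`.

The base case `P(4)` (`SL₂(ℤ/16)`) is NOT proved here; it is the remaining finite computation of the `2`-adic
block of the `SL₂(ℤ)`-invariant form of [CalegariDimitrovTang2025, Corollary 4.5.3] (whose proof in loc. cit.
uses Lemma 4.5.9 and a machine computation at levels `8` and `16`, Lemma 4.5.10).
-/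

open scoped MatrixGroups commutatorElement

universe u

namespace Literature.GroupTheory.ArithmeticGroups

namespace SL2TwoPowSchurMultiplier

open Matrix.SpecialLinearGroup

/-- **The generic `2`-adic descent step** (`e ≥ 5`).  Assume `P(e-1)`: every central extension of
`SL₂(ℤ/2^{e-1})` with kernel of exponent `2` and a lift `t'` of `T̄` with `t'^{2^{e-1}} = 1` has
`ker ∩ [·,·] = 1`.  Then for every central extension `π : E ↠ SL₂(ℤ/2^e)` with kernel of exponent `2` and every
lift `t` of `T̄`: `ker π ∩ [E, E] ⊆ ⟨t^{2^e}⟩`. [cite: Beyl1986, Theorem (Schur multiplier of SL(2,ℤ/m)), 2-primary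
part] -/
theorem step (e : ℕ) (he : 5 ≤ e) {E : Type u} [Group E] (π : E →* SL(2, ZMod (2 ^ e)))
    (hsurj : Function.Surjective π) (hcen : ∀ z : E, π z = 1 → ∀ g : E, g * z = z * g)
    (hK2 : ∀ z : E, π z = 1 → z ^ 2 = 1)
    (IH : ∀ (E' : Type u) [Group E'] (π' : E' →* SL(2, ZMod (2 ^ (e - 1)))), Function.Surjective π' →
      (∀ z : E', π' z = 1 → ∀ g : E', g * z = z * g) → (∀ z : E', π' z = 1 → z ^ 2 = 1) →
      ∀ t' : E', ((π' t' : SL(2, ZMod (2 ^ (e - 1)))) : Matrix (Fin 2) (Fin 2) (ZMod (2 ^ (e - 1)))) =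
        !![1, 1; 0, 1] → t' ^ 2 ^ (e - 1) = 1 →
      ∀ z : E', π' z = 1 → z ∈ commutator E' → z = 1)
    (t : E) (ht : ((π t : SL(2, ZMod (2 ^ e))) : Matrix (Fin 2) (Fin 2) (ZMod (2 ^ e))) = !![1, 1; 0, 1]) :
    ∀ z : E, π z = 1 → z ∈ commutator E → z ∈ Subgroup.zpowers (t ^ 2 ^ e) := by
  haveI : NeZero (2 ^ (e - 1)) := ⟨pow_ne_zero _ two_ne_zero⟩
  obtain ⟨l, hl'⟩ := hsurj ⟨!![1, 0; 1, 1], by simp [Matrix.det_fin_two_of]⟩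
  have hl : ((π l : SL(2, ZMod (2 ^ e))) : Matrix (Fin 2) (Fin 2) (ZMod (2 ^ e))) = !![1, 0; 1, 1] := by
    rw [hl']
  set eh : E := t ^ 2 ^ (e - 2) with heh
  set fh : E := l ^ 2 ^ (e - 2) with hfh
  set xh : E := t * fh * t⁻¹ with hxh
  -- the two reductions
  set r₂ := Matrix.SpecialLinearGroup.map (n := Fin 2)
    (ZMod.castHom (pow_dvd_pow 2 (Nat.sub_le e 2)) (ZMod (2 ^ (e - 2)))) with hr₂
  set r₁ := Matrix.SpecialLinearGroup.map (n := Fin 2)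
    (ZMod.castHom (pow_dvd_pow 2 (Nat.sub_le e 1)) (ZMod (2 ^ (e - 1)))) with hr₁
  -- the canonical complement: squares of the double-layer preimage
  have hmulA : ∀ x y : E, r₂ (π x) = 1 → r₂ (π y) = 1 → r₂ (π (x * y)) = 1 := fun x y hx hy ↦ by
    rw [map_mul, map_mul, hx, hy, mul_one]
  have hinvA : ∀ x : E, r₂ (π x) = 1 → r₂ (π x⁻¹) = 1 := fun x hx ↦ by rw [map_inv, map_inv, hx, inv_one]
  have hconjA : ∀ g x : E, r₂ (π x) = 1 → r₂ (π (g * x * g⁻¹)) = 1 := fun g x hx ↦ by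
    rw [map_mul, map_mul, map_mul, map_mul, hx, mul_one, map_inv, map_inv, mul_inv_cancel]
  have hcommA : ∀ x y : E, r₂ (π x) = 1 → r₂ (π y) = 1 → x * y = y * x := fun x y hx hy ↦
    SL2TwoPowCentralExtension.comm_of_double_layer hcen hK2 heh hfh hxh ht hl he hx hy
  let W : Subgroup E :=
    { carrier := {w | ∃ x : E, r₂ (π x) = 1 ∧ x * x = w}
      one_mem' := ⟨1, by rw [map_one, map_one], one_mul 1⟩
      mul_mem' := by
        rintro _ _ ⟨x, hx, rfl⟩ ⟨y, hy, rfl⟩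
        refine ⟨x * y, hmulA x y hx hy, ?_⟩
        calc x * y * (x * y) = x * (y * x) * y := by group
          _ = x * (x * y) * y := by rw [hcommA y x hy hx]
          _ = x * x * (y * y) := by group
      inv_mem' := by
        rintro _ ⟨x, hx, rfl⟩
        exact ⟨x⁻¹, hinvA x hx, by group⟩ }
  have hWmem : ∀ w, w ∈ W ↔ ∃ x : E, r₂ (π x) = 1 ∧ x * x = w := fun w ↦ Iff.rfl
  haveI hWn : W.Normal := ⟨by
    intro w hw g
    obtain ⟨x, hx, rfl⟩ := (hWmem w).mp hw
    exact (hWmem _).mpr ⟨g * x * g⁻¹, hconjA g x hx, by group⟩⟩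
  have hehA : r₂ (π eh) = 1 := SL2TwoPowCentralExtension.layer₂_eh heh ht
  have hfhA : r₂ (π fh) = 1 := by
    -- `f_h = s⁻¹-conjugate`-free argument: decompose via the image `L̄_a`, which reduces to `1`
    have hcast : ZMod.castHom (pow_dvd_pow 2 (Nat.sub_le e 2)) (ZMod (2 ^ (e - 2))) ((2 : ZMod (2 ^ e)) ^ (e - 2)) = 0 := by
      rw [map_pow, map_ofNat]
      have : ((2 ^ (e - 2) : ℕ) : ZMod (2 ^ (e - 2))) = 0 := ZMod.natCast_self _
      exact_mod_cast this
    rw [hr₂]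
    ext i j; fin_cases i <;> fin_cases j <;>
      simp [SL2TwoPowCentralExtension.coe_map_fh hfh hl, -ZMod.castHom_apply, map_one, hcast]
  have hxhA : r₂ (π xh) = 1 := by rw [hxh]; exact hconjA t fh hfhA
  have hehW : eh * eh ∈ W := (hWmem _).mpr ⟨eh, hehA, rfl⟩
  have hfhW : fh * fh ∈ W := (hWmem _).mpr ⟨fh, hfhA, rfl⟩
  have hxhW : xh * xh ∈ W := (hWmem _).mpr ⟨xh, hxhA, rfl⟩
  have hh0W : xh ^ 2 * eh ^ 2 * (fh ^ 2)⁻¹ ∈ W := by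
    rw [pow_two, pow_two, pow_two]
    exact mul_mem (mul_mem hxhW hehW) (inv_mem hfhW)
  -- `W` lies over the top layer
  have hWker : W ≤ (r₁.comp π).ker := by
    intro w hw
    obtain ⟨x, hx, rfl⟩ := (hWmem w).mp hw
    obtain ⟨i, j, k, z, hz, rfl⟩ := SL2TwoPowCentralExtension.exists_decomp₂ heh hfh hxh ht hl (by omega) hx
    have hπ2 : π (eh ^ (2 * i) * fh ^ (2 * j) * xh ^ (2 * k)) = π eh ^ (2 * i) * π fh ^ (2 * j) * π xh ^ (2 * k) := by
      simp only [map_mul, map_pow]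
    rw [MonoidHom.mem_ker, MonoidHom.comp_apply,
      SL2TwoPowCentralExtension.sq_decomp hcen hK2 heh hfh hxh ht hl he i j k hz, hπ2, hr₁]
    exact SL2DoubleLayer.map_castHom_pow_mul_pow_mul_pow_eq_one e (by omega) (π eh) (π fh) (π xh)
      (SL2TwoPowCentralExtension.coe_map_eh heh ht) (SL2TwoPowCentralExtension.coe_map_fh hfh hl)
      (SL2TwoPowCentralExtension.coe_map_xh hfh hxh ht hl) i j k
  -- the quotient extension of `SL₂(ℤ/2^{e-1})`
  let π' : E ⧸ W →* SL(2, ZMod (2 ^ (e - 1))) := QuotientGroup.lift W (r₁.comp π) hWker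
  have hπ' : ∀ x : E, π' (QuotientGroup.mk x) = r₁ (π x) := fun x ↦ rfl
  have hsurj' : Function.Surjective π' := by
    intro y
    obtain ⟨Y, hY⟩ := SL2TopLayer.map_castHom_surjective (2 ^ e) (pow_dvd_pow 2 (Nat.sub_le e 1)) y
    obtain ⟨x, hx⟩ := hsurj Y
    exact ⟨QuotientGroup.mk x, by rw [hπ', hx]; exact hY⟩
  have hker' : ∀ x : E, π' (QuotientGroup.mk x) = 1 → ∃ z : E, π z = 1 ∧ (QuotientGroup.mk x : E ⧸ W) =
      QuotientGroup.mk z := by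
    intro x hx
    rw [hπ'] at hx
    obtain ⟨a, b, c, z, hz, hxz⟩ := SL2TwoPowCentralExtension.exists_decomp₁ heh hfh hxh ht hl (by omega) hx
    have hxW : (eh ^ 2) ^ b * (xh ^ 2 * eh ^ 2 * (fh ^ 2)⁻¹) ^ a * (fh ^ 2) ^ c ∈ W := by
      refine mul_mem (mul_mem (pow_mem ?_ _) (pow_mem hh0W _)) (pow_mem ?_ _)
      · rw [pow_two]; exact hehW
      · rw [pow_two]; exact hfhW
    refine ⟨z, hz, ?_⟩
    rw [hxz, QuotientGroup.mk_mul, (QuotientGroup.eq_one_iff _).mpr hxW, one_mul]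
  have hcen' : ∀ q : E ⧸ W, π' q = 1 → ∀ g : E ⧸ W, g * q = q * g := by
    intro q hq g
    induction q using QuotientGroup.induction_on with
    | H x =>
      induction g using QuotientGroup.induction_on with
      | H y =>
        obtain ⟨z, hz, hxz⟩ := hker' x hq
        rw [hxz, ← QuotientGroup.mk_mul, ← QuotientGroup.mk_mul, hcen z hz y]
  have hK2' : ∀ q : E ⧸ W, π' q = 1 → q ^ 2 = 1 := by
    intro q hq
    induction q using QuotientGroup.induction_on with
    | H x =>
      obtain ⟨z, hz, hxz⟩ := hker' x hq
      rw [hxz, ← QuotientGroup.mk_pow, hK2 z hz, QuotientGroup.mk_one]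
  -- the lift `t̄` of `T̄` in the quotient and `t̄^{2^{e-1}} = 1`
  have ht' : ((π' (QuotientGroup.mk t) : SL(2, ZMod (2 ^ (e - 1)))) :
      Matrix (Fin 2) (Fin 2) (ZMod (2 ^ (e - 1)))) = !![1, 1; 0, 1] := by
    rw [hπ', hr₁]
    ext i j; fin_cases i <;> fin_cases j <;> simp [ht, -ZMod.castHom_apply, map_one]
  have htpow : (QuotientGroup.mk t : E ⧸ W) ^ 2 ^ (e - 1) = 1 := by
    rw [← QuotientGroup.mk_pow, SL2TwoPowCentralExtension.pow_half_eq_eh_sq heh (by omega),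
      QuotientGroup.eq_one_iff]
    exact hehW
  -- conclusion
  intro z hz hzc
  have h1 : π' (QuotientGroup.mk z) = 1 := by rw [hπ', hz, map_one]
  have h2 : (QuotientGroup.mk z : E ⧸ W) ∈ commutator (E ⧸ W) := by
    have := Subgroup.mem_map_of_mem (QuotientGroup.mk' W) hzc
    rw [commutator_def, Subgroup.map_commutator] at this
    rw [commutator_def]
    exact Subgroup.commutator_mono le_top le_top this
  have h3 := IH (E ⧸ W) π' hsurj' hcen' hK2' _ ht' htpow _ h1 h2
  have h4 : z ∈ W := (QuotientGroup.eq_one_iff z).mp h3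
  obtain ⟨x, hx, hxz⟩ := (hWmem z).mp h4
  rw [← hxz] at hz ⊢
  exact SL2TwoPowCentralExtension.sq_mem_zpowers hcen hK2 heh hfh hxh ht hl he hx hz

/-- `P(e-1) ⟹ P(e)` for `e ≥ 5`, where `P(n)` is the statement «for every central extension of `SL₂(ℤ/2ⁿ)` with
kernel of exponent `2` and every lift `t` of `T̄` with `t^{2ⁿ} = 1`, `ker ∩ [E, E] = 1`». [cite: Beyl1986,
Theorem (Schur multiplier of SL(2,ℤ/m)), 2-primary part] -/
theorem P_of_P_pred (e : ℕ) (he : 5 ≤ e)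
    (IH : ∀ (E' : Type u) [Group E'] (π' : E' →* SL(2, ZMod (2 ^ (e - 1)))), Function.Surjective π' →
      (∀ z : E', π' z = 1 → ∀ g : E', g * z = z * g) → (∀ z : E', π' z = 1 → z ^ 2 = 1) →
      ∀ t' : E', ((π' t' : SL(2, ZMod (2 ^ (e - 1)))) : Matrix (Fin 2) (Fin 2) (ZMod (2 ^ (e - 1)))) =
        !![1, 1; 0, 1] → t' ^ 2 ^ (e - 1) = 1 →
      ∀ z : E', π' z = 1 → z ∈ commutator E' → z = 1) :
    ∀ (E : Type u) [Group E] (π : E →* SL(2, ZMod (2 ^ e))), Function.Surjective π →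
      (∀ z : E, π z = 1 → ∀ g : E, g * z = z * g) → (∀ z : E, π z = 1 → z ^ 2 = 1) →
      ∀ t : E, ((π t : SL(2, ZMod (2 ^ e))) : Matrix (Fin 2) (Fin 2) (ZMod (2 ^ e))) = !![1, 1; 0, 1] →
        t ^ 2 ^ e = 1 →
      ∀ z : E, π z = 1 → z ∈ commutator E → z = 1 := by
  intro E _ π hsurj hcen hK2 t ht htpow z hz hzc
  have h := step e he π hsurj hcen hK2 IH t ht z hz hzc
  rw [htpow, Subgroup.zpowers_one_eq_bot, Subgroup.mem_bot] at h
  exact h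

/-- **The `2`-adic descent from the base level `16`.**  If `P(4)` holds (central extensions of `SL₂(ℤ/16)` with
kernel of exponent `2` and `t^{16} = 1` have `ker ∩ [E,E] = 1`), then `P(4 + n)` holds for every `n`. [cite:
Beyl1986, Theorem (Schur multiplier of SL(2,ℤ/m)), 2-primary part] -/
theorem forall_P_of_base
    (base : ∀ (E : Type u) [Group E] (π : E →* SL(2, ZMod (2 ^ 4))), Function.Surjective π →
      (∀ z : E, π z = 1 → ∀ g : E, g * z = z * g) → (∀ z : E, π z = 1 → z ^ 2 = 1) →
      ∀ t : E, ((π t : SL(2, ZMod (2 ^ 4))) : Matrix (Fin 2) (Fin 2) (ZMod (2 ^ 4))) = !![1, 1; 0, 1] →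
        t ^ 2 ^ 4 = 1 → ∀ z : E, π z = 1 → z ∈ commutator E → z = 1) (n : ℕ) :
    ∀ (E : Type u) [Group E] (π : E →* SL(2, ZMod (2 ^ (4 + n)))), Function.Surjective π →
      (∀ z : E, π z = 1 → ∀ g : E, g * z = z * g) → (∀ z : E, π z = 1 → z ^ 2 = 1) →
      ∀ t : E, ((π t : SL(2, ZMod (2 ^ (4 + n)))) : Matrix (Fin 2) (Fin 2) (ZMod (2 ^ (4 + n)))) =
        !![1, 1; 0, 1] → t ^ 2 ^ (4 + n) = 1 → ∀ z : E, π z = 1 → z ∈ commutator E → z = 1 := by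
  induction n with
  | zero => exact base
  | succ n ih =>
    have h := P_of_P_pred (4 + (n + 1)) (by omega)
    rw [show 4 + (n + 1) - 1 = 4 + n by omega] at h
    exact h ih

/-- **`ker π ∩ [E, E] ⊆ ⟨t^{2^e}⟩` for all `e ≥ 5`, given the base `P(4)`**: for every central extension
`π : E ↠ SL₂(ℤ/2^e)` with kernel of exponent `2` and every lift `t` of `T̄`. [cite: Beyl1986, Theorem (Schur
multiplier of SL(2,ℤ/m)), 2-primary part] -/
theorem mem_zpowers_of_base
    (base : ∀ (E : Type u) [Group E] (π : E →* SL(2, ZMod (2 ^ 4))), Function.Surjective π →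
      (∀ z : E, π z = 1 → ∀ g : E, g * z = z * g) → (∀ z : E, π z = 1 → z ^ 2 = 1) →
      ∀ t : E, ((π t : SL(2, ZMod (2 ^ 4))) : Matrix (Fin 2) (Fin 2) (ZMod (2 ^ 4))) = !![1, 1; 0, 1] →
        t ^ 2 ^ 4 = 1 → ∀ z : E, π z = 1 → z ∈ commutator E → z = 1)
    (e : ℕ) (he : 5 ≤ e) {E : Type u} [Group E] (π : E →* SL(2, ZMod (2 ^ e)))
    (hsurj : Function.Surjective π) (hcen : ∀ z : E, π z = 1 → ∀ g : E, g * z = z * g)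
    (hK2 : ∀ z : E, π z = 1 → z ^ 2 = 1) (t : E)
    (ht : ((π t : SL(2, ZMod (2 ^ e))) : Matrix (Fin 2) (Fin 2) (ZMod (2 ^ e))) = !![1, 1; 0, 1])
    {z : E} (hz : π z = 1) (hzc : z ∈ commutator E) : z ∈ Subgroup.zpowers (t ^ 2 ^ e) := by
  have h := forall_P_of_base base (e - 1 - 4)
  rw [show 4 + (e - 1 - 4) = e - 1 by omega] at h
  exact step e he π hsurj hcen hK2 h t ht z hz hzc

end SL2TwoPowSchurMultiplier

end Literature.GroupTheory.ArithmeticGroups
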